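import Summits.AnomalousDissipation.AnomalousDissipation.Theses.MarginalStabilityChain
import Summits.AnomalousDissipation.AnomalousDissipation.Theses.CoherentStates
import Summits.AnomalousDissipation.AnomalousDissipation.Theses.TwoAndHalfD
import Summits.AnomalousDissipation.AnomalousDissipation.Theorems.MarginalStabilityChainBurgersLayerKH
import Summits.AnomalousDissipation.AnomalousDissipation.Theorems.MarginalStabilityChainChainRealisationStubLoudOfContrast
import Summits.AnomalousDissipation.AnomalousDissipation.Theorems.TwohalfdNeg.Negative.LaminarShear
import Literature.Analysis.FunctionSpaces.TorusClassicalNSGluing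
import Literature.Analysis.FunctionSpaces.TorusLinearisedFormTruncation
import Literature.Analysis.FluidPDE.DoeringFoias
import HarnessLib

/-!
# Disproof of `ChainRealisation` — work file of the standing adversary (cdisprove) on the crux
# `MarginalStabilityChain.ChainRealisation` (stmt-AnomalousDissipation-14249, route MarginalStabilityChain, rank 9)

THE CRUX (read back from the elaborated term, probe `W.lean` rc 0):
`ChainRealisation : StrainedLayerLaw → BurgersLayerKH → StretchedVortexRows → ChainThesis` — the un-split REALISATION
IMPLICATION "unit cell ⇒ `T³` witness" of the route: from (2) the `ν`-independent single-layer law of the perturbed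
Burgers layer (stmt 3007, stretched two-dimensional Navier–Stokes class on `ℝ × (ℝ/Lℤ) × ℝ`), (3) the `ν`-uniform KH
mode of the exact Burgers layer (stmt 3008, an ODE eigenvalue statement — PROVED in tree,
`Theorems.BurgersLayerKH.Sheet.burgersLayerKH_proof`) and (4) steady stretched-vortex rows (stmt 3009, same class,
steady), conclude `ChainThesis` (stmt 3005): ONE smooth steady solenoidal mean-zero force on `T³`, `ν_j → 0`, COMPLETE
classical trajectories with bounded limsup-mean energy and limsup-mean dissipation `≥ ε > 0`.  The antecedents are
`ℝ²`/`ℝ`-typed, the consequent `T³`-typed; no transfer lemma exists, so the implication is formally inert (every line so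
far proves the consequent: `Lines/SketchIdeator2.lean` §0 `chainRealisation_of_chainThesis`).

FINDINGS INDEX (kernel-checked; prose only in docstrings; landed copies under `Theorems/ChainRealisation/Negative/`):
* §1 REDUCTION `chainRealisation_iff_reduced`: antecedent (3) is a theorem, so the crux ⇔
  `StrainedLayerLaw → StretchedVortexRows → ChainThesis`; `chainRealisation_iff_chainThesis_of`: given both open
  unit-cell cruxes it IS the target.  (Landed copy: `Negative/KillShape.lean`, p101370 ACCEPTED 2b7c8b0311b0.)
* §2 KILL SHAPE `not_chainRealisation_iff`: `¬ ChainRealisation ⇔ StrainedLayerLaw ∧ StretchedVortexRows ∧ ¬ ChainThesis`.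
  COST OF A KILL: proofs of BOTH open unit-cell cruxes (3007 rank 2, 3009 rank 4 — `unitCell_of_not_chainRealisation`)
  PLUS the negative zeroth law in the complete classical class (`¬ ChainThesis` ⇔ `ChainNeg` of
  `Cruxes/ChainThesis/Disproof.lean` §5; open in print, Bruè–De Lellis 2023 Q2.1–2.2), which would also kill route
  `CoherentStates`' target (`not_coherentThesis_of_not_chainRealisation`).  THREE DOORS `chainRealisation_iff_or`: the
  crux holds iff `¬StrainedLayerLaw` ∨ `¬StretchedVortexRows` ∨ `ChainThesis`; the two VACUITY doors are reported shut
  by the antecedents' standing files (`Cruxes/StrainedLayerLaw/Disproof.lean`: 3007 not refuted, `∃θ` load-bearing, no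
  ghost solutions of the stretched class — far fields pin both components at all times, the parallel steady solutions
  are exactly the Burgers layer; `Cruxes/StretchedVortexRows/Disproof.lean`: 3009 resists, its `ℝ≥0∞` junk
  (`∫⁻ = ⊤` satisfies the floor) sits on the TRUE side and needs a non-parallel steady solution nobody can write down).
  VERDICT: NO UNCONDITIONAL KILL IS POSSIBLE THIS CYCLE — a refutation is strictly harder than proving 3007 ∧ 3009 and
  refuting 3005 together.
* §3 LINE `SketchIdeator2` (lead c1; card `separatrix-flux-pinning`), RESIDUAL `ContrastFamily` — LOAD-BEARING ANALYSIS: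
  `contrastFamily_holds_without_energyCeiling` (delete `∀ j, meanEnergy (u j) ≤ E` ⇒ TRUE by the LAMINAR AXIAL BRANCH
  `g = 0`, `h = cos 2πx₀`, `u_j = (0,0,(j+1)cos(2πx₀)/(4π²))`, forward classical, constant enstrophy, mean zero, planar
  work `0`, contrast `(j+1)/(8π²)`; its energies `(j+1)²/(32π⁴)` exceed every ceiling, `laminarBranch_exceeds`);
  `contrastFamily_holds_without_vanishingViscosity` (delete `ν_j → 0` ⇒ TRUE at `ν = 1`).  So the ceiling is the ONLY
  clause separating the residual from the viscous response of the arena: the residual IS the `ν`-uniform energy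
  question (Bruè–De Lellis Q2.2) for the arena, as `Cruxes/ChainThesis/Disproof.lean` §3 found for the consequent.
  (Landed copy: `Negative/ResidualLaminarBranch.lean`, p103539 ACCEPTED 947203191fd8.)
* §4 LINE, RESIDUAL — SYMMETRY MUST BREAK `not_contrastFamilySymm_of_twohalfdNeg`: witnesses of the residual with
  `e₂`-translation-invariant slices (the `2½`-D class of the arena force itself: planar NS + passive axial scalar) form
  an `x₂`-invariant bounded-energy global Leray–Hopf family with `meanDissipation ≥ μa₀ > 0` (landed budget step,
  trajectory-wise: `dissipation_floor`), i.e. a counterexample to `TwoAndHalfD.TwohalfdNeg` (stmt 0211, open,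
  "plausible") and a witness of the shape of `TwohalfdThesis` (stmt 0206).  Modulo 0211 the contrast floor must be
  carried by genuinely 3-D secondary flow; an `x₂`-invariant construction of the residual is crux 0206 in disguise.
  (Landed copy: `Negative/ResidualSymmetric.lean`, p103548 ACCEPTED 947203191fd8.)
* §5 TARGETS / STUBS OF THE LINE (paper audit, no kill): the open TRUE stubs P1 `stub_pureBalance`, P2 `stub_windowP3`,
  P3 `stub_sobolevLadder`, P4 `stub_compactSublevel`, P5 `stub_phaseOfSmoothOrbit` were read symbol by symbol against
  `Torus.IsClassicalNSSolutionOn`, `IsNSPhase`, `Hsp`/`rep`/`enstrophyObs`, `eLaplacianNormSq`: signs of P1's balance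
  match the momentum equation (`∂ₜu + (u·∇)u = νΔu − ∇p + f`; viscous term `−ν‖∇∂ᵢᵐu‖²`, pressure drops on solenoidal
  `∂ᵢᵐu`), the extra hypothesis `IsSmooth (f t)` is automatic on `S` and harmless, `ν`'s sign is irrelevant for P1 (an
  identity) and `0 < ν` is present in P2–P5; P4's sublevel set is bounded in `L²` because `Hsp` is the MEAN-ZERO slice
  (`|k| ≥ 1`), closed by Fatou, totally bounded by the `N⁻⁴` tail — compact, with `enstrophyObs` Lipschitz on it by
  Cauchy–Schwarz in Fourier space; P5's `IsNSPhase` fields (compact `K`, semigroup on `K`, joint continuity on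
  `Ici 0 × K`, finite continuous enstrophy, classical trajectories through every point of `K`) are all met by the
  `H`-closure of a smooth all-orders-bounded forward orbit (limit points carry the `C^∞_loc` limits of translates).  No
  misstatement found; no stuck stubs were handed over (`targets = []`).  JOINT SUFFICIENCY is kernel-checked by the lead
  (`ChainRealisation_of`, §4 of the skeleton) and by the landed conditional glue
  `chainRealisation_of_forwardPhase_of_contrastFamily`.

WHY IT RESISTS.  The crux is an implication whose consequent is the route target and whose undischarged antecedents are
open existence/dynamics statements in an exact-solution class on `ℝ²`; classical logic (§2) makes its negation the
conjunction of two open positive statements with an open negative one.  The line's residual is honest (no junk: Cesàro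
means of energy, planar work and contrast are bounded on forward mean-zero enstrophy-bounded classical trajectories),
conjecture-grade by design (its proof for any arena is the zeroth law there; its refutation for a given arena is a
laminarisation theorem), and §3–§4 locate exactly where its content sits: the `ν`-uniform energy ceiling, and the
breaking of the arena's vertical translation symmetry.
-/

set_option linter.dupNamespace false

noncomputable section

namespace Summit.AnomalousDissipation.AnomalousDissipation.Cruxes.ChainRealisation.Disproof

open MeasureTheory Set Filter Topology
open scoped InnerProductSpace
open Literature.Analysis.FunctionSpaces Literature.Analysis.FunctionSpaces.Torus
open Literature.Analysis.FluidPDE Literature.Analysis.FluidPDE.Torus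
open Summit.AnomalousDissipation.AnomalousDissipation.Theses
open Summit.AnomalousDissipation.AnomalousDissipation.Theses.MarginalStabilityChain
open Summit.AnomalousDissipation.AnomalousDissipation.Theorems.BurgersLayerKH.Sheet (burgersLayerKH_proof)
open Summit.AnomalousDissipation.AnomalousDissipation.Theorems.ChainRealisation.SeparatrixFluxPinning
  (meanDissipation_eq_longTimeAvgSup_inner mul_le_longTimeAvgSup_inner_twoHalf hasZeroMean_twoHalf_smul)
open Summit.AnomalousDissipation.AnomalousDissipation.Theorems.TwohalfdNeg.Negative

/-! ## §0 The crux unfolded -/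

/-- The crux, unfolded (definitional): a curried implication from the three unit-cell statements to the route
target. [folklore] -/
theorem chainRealisation_iff :
    ChainRealisation ↔ (StrainedLayerLaw → BurgersLayerKH → StretchedVortexRows → ChainThesis) :=
  Iff.rfl

/-! ## §1 Reduction by the landed antecedent -/

open Summit.AnomalousDissipation.AnomalousDissipation.Theorems.BurgersLayerKH.Sheet (burgersLayerKH_proof)

/-- **REDUCTION.** With `BurgersLayerKH` proved, the crux is equivalent to the two-antecedent implication
`StrainedLayerLaw → StretchedVortexRows → ChainThesis`. [folklore] -/
theorem chainRealisation_iff_reduced :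
    ChainRealisation ↔ (StrainedLayerLaw → StretchedVortexRows → ChainThesis) :=
  ⟨fun h h2 h4 => h h2 burgersLayerKH_proof h4, fun h h2 _ h4 => h h2 h4⟩

/-- Given BOTH open unit-cell cruxes, the crux is literally the route target. [folklore] -/
theorem chainRealisation_iff_chainThesis_of (h2 : StrainedLayerLaw) (h4 : StretchedVortexRows) :
    ChainRealisation ↔ ChainThesis :=
  ⟨fun h => h h2 burgersLayerKH_proof h4, fun h _ _ _ => h⟩

/-! ## §2 The exact shape of a kill, its cost, and the three doors -/

/-- **EXACT SHAPE OF A KILL.** `¬ ChainRealisation` iff the single-layer law AND the steady stretched-vortex rows hold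
AND the disruption-chain witness fails.  (Classical logic on a curried implication whose middle antecedent is a
theorem.) [folklore] -/
theorem not_chainRealisation_iff :
    ¬ ChainRealisation ↔ (StrainedLayerLaw ∧ StretchedVortexRows ∧ ¬ ChainThesis) := by
  rw [chainRealisation_iff_reduced]
  constructor
  · intro h
    by_cases h2 : StrainedLayerLaw
    · by_cases h4 : StretchedVortexRows
      · exact ⟨h2, h4, fun hX => h fun _ _ => hX⟩
      · exact absurd (fun _ h4' => absurd h4' h4) h
    · exact absurd (fun h2' _ => absurd h2' h2) h
  · rintro ⟨h2, h4, hX⟩ h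
    exact hX (h h2 h4)

/-- **COST OF A KILL, (i)+(ii)**: any refutation of the crux contains proofs of BOTH open unit-cell cruxes
(stmt 3007 `StrainedLayerLaw`, stmt 3009 `StretchedVortexRows`). [folklore] -/
theorem unitCell_of_not_chainRealisation (h : ¬ ChainRealisation) : StrainedLayerLaw ∧ StretchedVortexRows :=
  ⟨(not_chainRealisation_iff.1 h).1, (not_chainRealisation_iff.1 h).2.1⟩

/-- **COST OF A KILL, (iii)**: any refutation of the crux refutes the route target `ChainThesis` — the negative
zeroth law for complete classical trajectories under ONE steady force (open). [folklore] -/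
theorem not_chainThesis_of_not_chainRealisation (h : ¬ ChainRealisation) : ¬ ChainThesis :=
  (not_chainRealisation_iff.1 h).2.2

/-- … and hence refutes the target of route `CoherentStates` as well (`CoherentThesis`: the same witness class with
time-PERIODIC complete classical trajectories — periodic witnesses are witnesses). [folklore] -/
theorem not_coherentThesis_of_not_chainRealisation (h : ¬ ChainRealisation) : ¬ CoherentStates.CoherentThesis := by
  rintro ⟨f, hs, hd, hz, ν, τ, u, p, hν, hν0, hsol, hE, hε⟩
  exact not_chainThesis_of_not_chainRealisation h
    ⟨f, hs, hd, hz, ν, u, p, hν, hν0, fun j => (hsol j).1, hE, hε⟩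

/-- **THE THREE DOORS.** The crux holds iff antecedent (2) fails, or antecedent (4) fails, or the target holds.
The first two are VACUITY doors (a refutation of `StrainedLayerLaw` or of `StretchedVortexRows` closes this item
`proved` while breaking the route); the third is the honest door. [folklore] -/
theorem chainRealisation_iff_or :
    ChainRealisation ↔ (¬ StrainedLayerLaw ∨ ¬ StretchedVortexRows ∨ ChainThesis) := by
  rw [chainRealisation_iff_reduced]
  constructor
  · intro h
    by_cases h2 : StrainedLayerLaw
    · by_cases h4 : StretchedVortexRows
      · exact Or.inr (Or.inr (h h2 h4))
      · exact Or.inr (Or.inl h4)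
    · exact Or.inl h2
  · rintro (h2 | h4 | hX) h2' h4'
    · exact absurd h2' h2
    · exact absurd h4' h4
    · exact hX


/-! ## §3 Line `SketchIdeator2`: the residual minus its energy ceiling is the laminar axial branch -/

/-! ### §3a The laminar axial branch of the arena `(0, 0, cos 2πx₀)` -/

/-- `4π²·1²·ν_j·a_j = 1` for `ν_j = 1/(j+1)`, `a_j = (j+1)/(4π²)`. [folklore] -/
theorem amp_rel (j : ℕ) :
    4 * Real.pi ^ 2 * (((0 : ℕ) : ℝ) + 1) ^ 2 * (1 / ((j : ℝ) + 1)) * (((j : ℝ) + 1) / (4 * Real.pi ^ 2)) = 1 := by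
  have hj : (j : ℝ) + 1 ≠ 0 := by positivity
  have hπ : (Real.pi : ℝ) ^ 2 ≠ 0 := by positivity
  push_cast
  field_simp
  ring

/-- **The laminar axial state is a FORWARD classical solution of the arena system.**  For the arena force
`twoHalf 0 ((1:ℝ) • cos 2πx₀) = (0,0,cos 2πx₀)` and `ν_j = 1/(j+1)`, the steady shear `(0,0,(j+1)cos(2πx₀)/(4π²))` with
zero pressure is classical on `[0,∞) × T³` (restriction of the complete laminar solution `isClassicalNSSolutionOn_shear`
of `TwohalfdNeg.Negative` by `Torus.IsClassicalNSSolutionOn.mono`). [folklore] -/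
theorem isClassicalNSSolutionOn_laminarBranch (j : ℕ) :
    IsClassicalNSSolutionOn (Set.Ici 0) (1 / ((j : ℝ) + 1))
      (fun _ => twoHalf (0 : UnitAddTorus (Fin 2) → EuclideanSpace ℝ (Fin 2)) ((1 : ℝ) • profile 0 1))
      (fun _ => shear 0 (((j : ℝ) + 1) / (4 * Real.pi ^ 2)))
      (fun _ => (fun _ : UnitAddTorus (Fin 2) => (0 : ℝ)) ∘ planarProj) := by
  have h := isClassicalNSSolutionOn_shear 0 (1 / ((j : ℝ) + 1)) (((j : ℝ) + 1) / (4 * Real.pi ^ 2))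
  rw [amp_rel j] at h
  rw [one_smul]
  exact h.mono (subset_univ _) (uniqueDiffOn_Ici 0)

/-- Third component of the shear state: `(shear 0 a x)₂ = a cos(2πx₀)`. [folklore] -/
theorem shear_apply_two (a : ℝ) (x : UnitAddTorus (Fin 3)) : shear 0 a x 2 = profile 0 a (planarProj x) := by
  show twoHalf 0 (profile 0 a) x 2 = _
  exact twoHalf_apply_two _ _ _

/-- **The axial contrast of the laminar branch**: `∫ cos(2πx₀) · a cos(2πx₀) dx = a/2`. [folklore] -/
theorem contrast_laminarBranch (a : ℝ) :
    ∫ x : UnitAddTorus (Fin 3), profile 0 1 (planarProj x) * shear 0 a x 2 = a / 2 := by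
  simp_rw [shear_apply_two]
  have hb : AEStronglyMeasurable (fun y : UnitAddTorus (Fin 2) => profile 0 1 y * profile 0 a y) volume :=
    ((continuous_profile 0 1).mul (continuous_profile 0 a)).aestronglyMeasurable
  rw [show (fun x : UnitAddTorus (Fin 3) => profile 0 1 (planarProj x) * profile 0 a (planarProj x)) =
      fun x => (fun y : UnitAddTorus (Fin 2) => profile 0 1 y * profile 0 a y) (planarProj x) from rfl,
    integral_comp_planarProj hb]
  have hpt : ∀ y : UnitAddTorus (Fin 2), profile 0 1 y * profile 0 a y = a * profile 0 1 y ^ 2 := fun y => by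
    rw [show profile 0 a y = profile 0 (a * 1) y by rw [mul_one], profile_mul]
    ring
  simp_rw [hpt]
  rw [integral_const_mul, integral_profile_sq]
  ring

/-- The axial-contrast functional of the (steady) laminar branch is the constant `a/2`. [folklore] -/
theorem contrast_laminarBranch_fun (a : ℝ) :
    (fun t : ℝ => ∫ x : UnitAddTorus (Fin 3),
        profile 0 1 (planarProj x) * (fun _ : ℝ => shear 0 a) t x 2) = fun _ => a / 2 := by
  funext t
  exact contrast_laminarBranch a

/-- The planar-work functional of the laminar branch vanishes identically (no planar force). [folklore] -/
theorem planarWork_laminarBranch_fun (a : ℝ) :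
    (fun t : ℝ => ∫ x : UnitAddTorus (Fin 3),
        ⟪(0 : UnitAddTorus (Fin 2) → EuclideanSpace ℝ (Fin 2)) (planarProj x),
          planarProjE ((fun _ : ℝ => shear 0 a) t x)⟫_ℝ) = fun _ => (0 : ℝ) := by
  funext t
  simp

/-- `liminf` long-time average of the zero functional. [folklore] -/
theorem longTimeAvgInf_zero_fun : longTimeAvgInf (fun _ : ℝ => (0 : ℝ)) = 0 := by
  rw [longTimeAvgInf, timeMean_zero_fun, liminf_const]

/-- **Mean energy of the laminar branch**: `⟨‖u_j‖²⟩ = a_j²/2 = (j+1)²/(32π⁴)`. [folklore] -/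
theorem meanEnergy_laminarBranch (j : ℕ) :
    meanEnergy (fun _ : ℝ => shear 0 (((j : ℝ) + 1) / (4 * Real.pi ^ 2))) =
      ((j : ℝ) + 1) ^ 2 / (32 * Real.pi ^ 4) := by
  rw [meanEnergy_shear]
  have hπ : (Real.pi : ℝ) ≠ 0 := Real.pi_ne_zero
  field_simp
  ring

/-- **THE LAMINAR BRANCH VIOLATES EVERY CEILING**: for every `E` some level `j` has `meanEnergy (u_j) > E`
(energies `∝ (j+1)² = ν_j⁻²`). [folklore] -/
theorem laminarBranch_exceeds (E : ℝ) :
    ∃ j : ℕ, E < meanEnergy (fun _ : ℝ => shear 0 (((j : ℝ) + 1) / (4 * Real.pi ^ 2))) := by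
  obtain ⟨j, hj⟩ := exists_nat_gt (E * (32 * Real.pi ^ 4))
  refine ⟨j, ?_⟩
  rw [meanEnergy_laminarBranch, lt_div_iff₀ (by positivity)]
  have h1 : (j : ℝ) < ((j : ℝ) + 1) ^ 2 := by nlinarith [(Nat.cast_nonneg j : (0 : ℝ) ≤ j)]
  linarith

/-! ### §3b The energy ceiling is load-bearing; so is `ν_j → 0` -/

/-- **THE ENERGY CEILING IS THE LOAD-BEARING CLAUSE OF THE RESIDUAL.**  The statement proved is the line's residual
`ContrastFamily` (arena force written `twoHalf g (μ • h)` as in the landed stub files) with the clause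
`∀ j, meanEnergy (u j) ≤ E` DELETED and everything else verbatim.  It is TRUE by the laminar axial branch: `g = 0`,
`h = cos 2πx₀`, `μ = 1`, `a₀ = 1/(8π²)`, `ν_j = 1/(j+1)`, `u_j = (0,0,(j+1)cos(2πx₀)/(4π²))` (forward classical, constant
enstrophy, mean zero, planar work `0`, contrast `(j+1)/(8π²)`).  Hence a proof of the residual must USE the ceiling
against this branch (its energies are `(j+1)²/(32π⁴)`, `laminarBranch_exceeds`), and a disproof of the residual is a
statement about ENERGY-BOUNDED families only. [folklore] -/
theorem contrastFamily_holds_without_energyCeiling :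
    ∃ (g : UnitAddTorus (Fin 2) → EuclideanSpace ℝ (Fin 2)) (h : UnitAddTorus (Fin 2) → ℝ) (μ a₀ : ℝ),
      IsSmooth g ∧ IsDivFree g ∧ HasZeroMean g ∧ IsSmooth h ∧ HasZeroMean h ∧ 0 < μ ∧ 0 < a₀ ∧
      ∃ (ν : ℕ → ℝ) (u : ℕ → ℝ → UnitAddTorus (Fin 3) → EuclideanSpace ℝ (Fin 3))
        (p : ℕ → ℝ → UnitAddTorus (Fin 3) → ℝ),
        (∀ j, 0 < ν j) ∧ Tendsto ν atTop (nhds 0) ∧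
        (∀ j, IsClassicalNSSolutionOn (Set.Ici 0) (ν j) (fun _ => twoHalf g (μ • h)) (u j) (p j)) ∧
        (∀ j, ∃ M : ℝ, ∀ t : ℝ, 0 ≤ t → gradNormSq (u j t) ≤ M) ∧
        (∀ j t, 0 ≤ t → HasZeroMean (u j t)) ∧
        (∀ j, 0 ≤ longTimeAvgInf (fun t => ∫ x, ⟪g (planarProj x), planarProjE (u j t x)⟫_ℝ)) ∧
        (∀ j, a₀ ≤ longTimeAvgSup (fun t => ∫ x, h (planarProj x) * u j t x 2)) := by
  refine ⟨0, profile 0 1, 1, 1 / (8 * Real.pi ^ 2), isSmooth_zero₂,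
    fun x => by simp [Torus.divergence, Torus.partialDeriv, Torus.lineDeriv], hasZeroMean_zero₂,
    isSmooth_profile 0 1, hasZeroMean_profile 0 1, one_pos, by positivity,
    fun j => 1 / ((j : ℝ) + 1), fun j _ => shear 0 (((j : ℝ) + 1) / (4 * Real.pi ^ 2)),
    fun _ _ => (fun _ : UnitAddTorus (Fin 2) => (0 : ℝ)) ∘ planarProj,
    fun j => by positivity, tendsto_one_div_add_atTop_nhds_zero_nat, isClassicalNSSolutionOn_laminarBranch,
    fun j => ⟨gradNormSq (shear 0 (((j : ℝ) + 1) / (4 * Real.pi ^ 2))), fun _ _ => le_rfl⟩,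
    fun j _ _ => hasZeroMean_shear 0 _, fun j => ?_, fun j => ?_⟩
  · rw [planarWork_laminarBranch_fun, longTimeAvgInf_zero_fun]
  · rw [contrast_laminarBranch_fun, longTimeAvgSup_const_fun, div_div,
      div_le_div_iff₀ (by positivity) (by positivity)]
    nlinarith [Real.pi_pos, (Nat.cast_nonneg j : (0 : ℝ) ≤ j), pow_pos Real.pi_pos 2]

/-- **`ν_j → 0` IS LOAD-BEARING** (sanity): the residual with `Tendsto ν atTop (nhds 0)` DELETED (everything else
verbatim, energy ceiling included) is TRUE at the constant viscosity `ν = 1` by the laminar branch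
`u = (0,0,cos(2πx₀)/(4π²))`, with `E = 1/(32π⁴)`, `a₀ = 1/(8π²)`. [folklore] -/
theorem contrastFamily_holds_without_vanishingViscosity :
    ∃ (g : UnitAddTorus (Fin 2) → EuclideanSpace ℝ (Fin 2)) (h : UnitAddTorus (Fin 2) → ℝ) (μ a₀ E : ℝ),
      IsSmooth g ∧ IsDivFree g ∧ HasZeroMean g ∧ IsSmooth h ∧ HasZeroMean h ∧ 0 < μ ∧ 0 < a₀ ∧
      ∃ (ν : ℕ → ℝ) (u : ℕ → ℝ → UnitAddTorus (Fin 3) → EuclideanSpace ℝ (Fin 3))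
        (p : ℕ → ℝ → UnitAddTorus (Fin 3) → ℝ),
        (∀ j, 0 < ν j) ∧
        (∀ j, IsClassicalNSSolutionOn (Set.Ici 0) (ν j) (fun _ => twoHalf g (μ • h)) (u j) (p j)) ∧
        (∀ j, ∃ M : ℝ, ∀ t : ℝ, 0 ≤ t → gradNormSq (u j t) ≤ M) ∧
        (∀ j t, 0 ≤ t → HasZeroMean (u j t)) ∧
        (∀ j, meanEnergy (u j) ≤ E) ∧
        (∀ j, 0 ≤ longTimeAvgInf (fun t => ∫ x, ⟪g (planarProj x), planarProjE (u j t x)⟫_ℝ)) ∧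
        (∀ j, a₀ ≤ longTimeAvgSup (fun t => ∫ x, h (planarProj x) * u j t x 2)) := by
  refine ⟨0, profile 0 1, 1, 1 / (8 * Real.pi ^ 2), 1 / (32 * Real.pi ^ 4), isSmooth_zero₂,
    fun x => by simp [Torus.divergence, Torus.partialDeriv, Torus.lineDeriv], hasZeroMean_zero₂,
    isSmooth_profile 0 1, hasZeroMean_profile 0 1, one_pos, by positivity,
    fun _ => 1 / (((0 : ℕ) : ℝ) + 1), fun _ _ => shear 0 ((((0 : ℕ) : ℝ) + 1) / (4 * Real.pi ^ 2)),
    fun _ _ => (fun _ : UnitAddTorus (Fin 2) => (0 : ℝ)) ∘ planarProj,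
    fun _ => by positivity, fun _ => isClassicalNSSolutionOn_laminarBranch 0,
    fun _ => ⟨gradNormSq (shear 0 ((((0 : ℕ) : ℝ) + 1) / (4 * Real.pi ^ 2))), fun _ _ => le_rfl⟩,
    fun _ _ _ => hasZeroMean_shear 0 _, fun _ => ?_, fun _ => ?_, fun _ => ?_⟩
  · rw [meanEnergy_laminarBranch]
    push_cast
    norm_num
  · rw [planarWork_laminarBranch_fun, longTimeAvgInf_zero_fun]
  · rw [contrast_laminarBranch_fun, longTimeAvgSup_const_fun]
    push_cast
    exact le_of_eq (by ring)


/-! ## §4 Line `SketchIdeator2`: symmetric witnesses of the residual contradict `TwohalfdNeg` -/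

/-- The arena force is invariant under vertical translations (it is a planar lift). [folklore] -/
theorem twoHalf_add_single (g : (UnitAddTorus (Fin 2)) → (EuclideanSpace ℝ (Fin 2))) (k : (UnitAddTorus (Fin 2)) → ℝ) (s : UnitAddCircle) (x : (UnitAddTorus (Fin 3))) :
    twoHalf g k (x + Pi.single (2 : Fin 3) s) = twoHalf g k x := by
  rw [twoHalf_eq_comp, Function.comp_apply, Function.comp_apply]
  exact comp_planarProj_add_single (fun y => planarEmbed (g y, k y)) s x

/-- **Forward pointwise energy bound of a residual trajectory** (mean-zero slices with bounded enstrophy; Poincaré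
`4π²∫‖u‖² ≤ ‖∇u‖₂²`). [folklore] -/
theorem forward_energy_bound {ν : ℝ} {f : (UnitAddTorus (Fin 3)) → (EuclideanSpace ℝ (Fin 3))} {u : ℝ → (UnitAddTorus (Fin 3)) → (EuclideanSpace ℝ (Fin 3))} {p : ℝ → (UnitAddTorus (Fin 3)) → ℝ}
    (hsol : IsClassicalNSSolutionOn (Set.Ici 0) ν (fun _ => f) u p)
    (hM : ∃ M : ℝ, ∀ t : ℝ, 0 ≤ t → gradNormSq (u t) ≤ M) (hzm : ∀ t : ℝ, 0 ≤ t → HasZeroMean (u t)) :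
    ∃ C : ℝ, ∀ t : ℝ, 0 ≤ t → ∫ x, ‖u t x‖ ^ 2 ≤ C := by
  obtain ⟨M, hMt⟩ := hM
  refine ⟨M / (4 * Real.pi ^ 2), fun t ht => ?_⟩
  have hsm : IsSmooth (u t) := hsol.smooth_velocity.isSmooth_slice (Set.mem_Ici.2 ht)
  have hP := four_pi_sq_mul_integral_norm_sq_le_gradNormSq hsm (hzm t ht)
  rw [le_div_iff₀ (by positivity)]
  calc (∫ x, ‖u t x‖ ^ 2) * (4 * Real.pi ^ 2) = 4 * Real.pi ^ 2 * ∫ x, ‖u t x‖ ^ 2 := by ring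
    _ ≤ gradNormSq (u t) := hP
    _ ≤ M := hMt t ht

/-- **Dissipation floor of a residual trajectory** (the landed budget step of the line, trajectory-wise): energy
equality makes `meanDissipation` the `limsup`-mean injected power, which the planar-work sign and the contrast floor
bound below by `μ a₀`. [folklore] -/
theorem dissipation_floor {g : (UnitAddTorus (Fin 2)) → (EuclideanSpace ℝ (Fin 2))} {h : (UnitAddTorus (Fin 2)) → ℝ} {μ a₀ ν : ℝ} (hg : IsSmooth g) (hh : IsSmooth h)
    (hμ : 0 ≤ μ) {u : ℝ → (UnitAddTorus (Fin 3)) → (EuclideanSpace ℝ (Fin 3))} {p : ℝ → (UnitAddTorus (Fin 3)) → ℝ}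
    (hsol : IsClassicalNSSolutionOn (Set.Ici 0) ν (fun _ => twoHalf g (μ • h)) u p)
    (hM : ∃ M : ℝ, ∀ t : ℝ, 0 ≤ t → gradNormSq (u t) ≤ M) (hzm : ∀ t : ℝ, 0 ≤ t → HasZeroMean (u t))
    (hIg : 0 ≤ longTimeAvgInf (fun t => ∫ x, ⟪g (planarProj x), planarProjE (u t x)⟫_ℝ))
    (hIh : a₀ ≤ longTimeAvgSup (fun t => ∫ x, h (planarProj x) * u t x 2)) :
    μ * a₀ ≤ meanDissipation ν u := by
  obtain ⟨C, hC⟩ := forward_energy_bound hsol hM hzm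
  rw [meanDissipation_eq_longTimeAvgSup_inner hsol (hg.twoHalf (hh.smul μ)) hC]
  exact mul_le_longTimeAvgSup_inner_twoHalf hg hh hμ hsol.smooth_velocity hC hIg hIh

/-- **SYMMETRIC WITNESSES OF THE RESIDUAL CONTRADICT `TwohalfdNeg`.**  The negated statement is the line's residual
`ContrastFamily` RESTRICTED TO THE `2½`-DIMENSIONAL CLASS ("`ContrastFamilySymm`"): verbatim (arena force written
`twoHalf g (μ • h)` as in the landed stub files) plus the last clause, invariance of every slice `u j t` under the
vertical translations `x ↦ x + s e₂` (all `t`; values at `t < 0` are junk for a forward solution, so up to redefinition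
at negative times this is the restriction for `t ≥ 0`).  If the negative `2½`-dimensional crux `TwoAndHalfD.TwohalfdNeg`
(stmt 0211) holds, the residual has NO such witness family: such a family is an `x₂`-invariant bounded-energy global Leray–Hopf family under the
`x₂`-invariant arena force with `meanDissipation ≥ μ a₀ > 0` at every level, which `TwohalfdNeg` sends to `0`.
Contrapositive reading: an `x₂`-invariant construction of the residual refutes 0211 and proves the shape of
`TwohalfdThesis` (0206). [folklore] -/
theorem not_contrastFamilySymm_of_twohalfdNeg (hN : TwoAndHalfD.TwohalfdNeg) :
    ¬ ∃ (g : (UnitAddTorus (Fin 2)) → (EuclideanSpace ℝ (Fin 2))) (h : (UnitAddTorus (Fin 2)) → ℝ) (μ a₀ E : ℝ),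
      IsSmooth g ∧ IsDivFree g ∧ HasZeroMean g ∧ IsSmooth h ∧ HasZeroMean h ∧ 0 < μ ∧ 0 < a₀ ∧
      ∃ (ν : ℕ → ℝ) (u : ℕ → ℝ → (UnitAddTorus (Fin 3)) → (EuclideanSpace ℝ (Fin 3))) (p : ℕ → ℝ → (UnitAddTorus (Fin 3)) → ℝ),
        (∀ j, 0 < ν j) ∧ Tendsto ν atTop (nhds 0) ∧
        (∀ j, IsClassicalNSSolutionOn (Set.Ici 0) (ν j) (fun _ => twoHalf g (μ • h)) (u j) (p j)) ∧
        (∀ j, ∃ M : ℝ, ∀ t : ℝ, 0 ≤ t → gradNormSq (u j t) ≤ M) ∧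
        (∀ j t, 0 ≤ t → HasZeroMean (u j t)) ∧
        (∀ j, meanEnergy (u j) ≤ E) ∧
        (∀ j, 0 ≤ longTimeAvgInf (fun t => ∫ x, ⟪g (planarProj x), planarProjE (u j t x)⟫_ℝ)) ∧
        (∀ j, a₀ ≤ longTimeAvgSup (fun t => ∫ x, h (planarProj x) * u j t x 2)) ∧
        (∀ j (t : ℝ) (s : UnitAddCircle) (x : (UnitAddTorus (Fin 3))), u j t (x + Pi.single (2 : Fin 3) s) = u j t x) := by
  rintro ⟨g, h, μ, a₀, E, hg, hgdiv, hg0, hh, hh0, hμ, ha₀, ν, u, p, hν, hν0, hsol, hM, hzm, hE, hIg, hIh, hsymm⟩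
  -- (i) the arena force is an admissible `x₂`-invariant steady force
  have hf : IsSmooth (twoHalf g (μ • h)) := hg.twoHalf (hh.smul μ)
  have hdiv : IsDivFree (twoHalf g (μ • h)) := hgdiv.twoHalf _
  have hmean : HasZeroMean (twoHalf g (μ • h)) := hasZeroMean_twoHalf_smul hg hh hg0 hh0 μ
  -- (ii) forward classical trajectories are global Leray–Hopf solutions from `u j 0`
  have hLH : ∀ j, IsGlobalLerayHopf (ν j) (fun _ => twoHalf g (μ • h)) (u j 0) (u j) := fun j T hT =>
    (hsol j).isLerayHopfOn_of_convex (convex_Ici 0) hT Icc_subset_Ici_self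
  -- `TwohalfdNeg` evaluated on the family
  have htend : Tendsto (fun j => meanDissipation (ν j) (u j)) atTop (nhds 0) :=
    hN (twoHalf g (μ • h)) (twoHalf_add_single g (μ • h)) hf hdiv hmean ν (fun j => u j 0) u hν hν0 hLH hsymm
      ⟨E, hE⟩
  -- (iii) but every level dissipates at least `μ a₀ > 0`
  have hfloor : ∀ j, μ * a₀ ≤ meanDissipation (ν j) (u j) := fun j =>
    dissipation_floor hg hh hμ.le (hsol j) (hM j) (hzm j) (hIg j) (hIh j)
  exact not_tendsto_zero_of_le (mul_pos hμ ha₀) hfloor htend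

/-! ## §5 Targets (stubs of line `SketchIdeator2`) and near-misses

No stuck stubs were handed over this cycle (`targets = []`).  The five open TRUE stubs P1–P5 of the skeleton were
audited on paper (module docstring §5): no misstatement, no junk instance, no kill.  The residual `stub_contrastFamily`
is attacked in §3–§4.  NEAR-MISS (not formalised, recorded for the next cycle): with `g = 0` the `2½`-D class of the
arena reduces to the heat semigroup for the axial scalar once the unforced planar flow has decayed, whose bounded-variance
states have contrast `O(ν · variance)` — an UNCONDITIONAL `¬ ContrastFamilySymm` for `g = 0` should follow from planar
free decay (`TwohalfdNeg/Negative/FreeDecay.lean`) plus a scalar stability estimate; it was not attempted because the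
scalar half needs forced advection–diffusion energy estimates along a decaying (not zero) drift that the tree does not
yet provide. -/

end Summit.AnomalousDissipation.AnomalousDissipation.Cruxes.ChainRealisation.Disproof

end
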